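import Mathlib
import Summits.NavierStokesRegularity.NavierStokesRegularity.Theorems.ThreadingFluxAzimuthalCartanCrossFlowNoAxis
import HarnessLib

/-!
# Crux `PoloidalLiouville` (stmt-NavierStokesRegularity-1222, wall W1), crux idea «azimuthal-cartan-test» (ns-idea-15 g10):
# THE SECTORIAL CROSS FLOWS REFUTE BALL-LOCAL RIGIDITY AT EVERY AXIS POINT AND ON EVERY BALL OFF THE AXIS PLANE

Support file (`--supports stmt-NavierStokesRegularity-1222`, helper; cell `ns-wall-extremal`, width hand ns-wall-eng-7 g7, 0 kit).
K♭ (`…SectorialCrossFlows`) is stated on the one ball `ball xTest 1` with centre `0`.  The critic's register line reads «exact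
non-axisymmetric unthreaded steady NS flows exist on EVERY ball missing the axis»; this file makes that sentence a kernel fact for the
half-space `{x₀ > 0}` and for EVERY centre `c e₂` on the symmetry axis of the construction.  For `u = crossFlow γ`, `γ ≠ 0`:

* `inner_sub_axis_curl_crossFlow` — `⟪y − c e₂, curl u y⟫ = 0`: unthreaded about every point of the axis;
* `curl_crossFlow_ne_zero` — `curl u y ≠ 0` at every point of the half-space;
* `crossFlow_not_homogeneous_at` — `Du(y)[y − c e₂] ≠ −u(y)` at every point of the half-space (first components differ by `2γ y₀/ρ²`);
* ★ `crossFlow_noAxis_on` — on every NONEMPTY OPEN `U ⊆ {x₀ > 0}` there is no skew `A ≠ 0` with `Du(y)[A(y − c e₂)] = A u(y)`: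
  the third row of the identity is `z`-affine with `z`-independent right-hand side (two points `y`, `y + δe₂`), giving `y₀w₁ = y₁w₀` at
  two points with different `y₁` ⇒ `w₀ = w₁ = 0`; the first row at a point with `y₁ ≠ 0` then gives `w₂ = 0`;
* ★★ `sectorialCrossFlows_everyBall` — for every ball `B ⊆ {x₀ > 0}` and every `c`: all seven clauses of K♭ on `B` with centre `c e₂`;
  `steadyLocalRigidityOffCentre_fails_everyBall` — the body of C♭ fails there.

HONEST FRAME: negative-side information on one idea card's local statement; C♯ (full shells), I♭ (tori), `PoloidalLiouville` (1222) and NS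
regularity OPEN; W1 movement 0.
-/

-- the summit and its single sub-problem share the name (CONVENTIONS §1)
set_option linter.dupNamespace false

noncomputable section

namespace Summit.NavierStokesRegularity.NavierStokesRegularity.Theorems.PoloidalLiouville.AzimuthalCartan.CrossFlow

open Set Function Filter Topology Metric
open scoped ContDiff RealInnerProductSpace
open Literature.Analysis.FluidPDE (curl cross)
open Summit.NavierStokesRegularity.NavierStokesRegularity.Theorems.PoloidalLiouville.CentreJet (E3 IsSteadyNSOn)
open Summit.NavierStokesRegularity.NavierStokesRegularity.Theorems.PoloidalLiouville.AzimuthalCartan.HalfSpace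
open Summit.NavierStokesRegularity.NavierStokesRegularity.Theorems.PoloidalLiouville.AzimuthalCartan.Axial
-- components of the cross product (tree lemmas, `RotatingEulerWindowProfileLinearRung`)
open Summit.NavierStokesRegularity.NavierStokesRegularity.Theorems.RotatingEulerWindowProfileLinearRung
  (cross_apply_zero cross_apply_one cross_apply_two)

variable (γ : ℝ)

/-- Coordinates of the axis point `c e₂`. -/
theorem axisPoint_apply (c : ℝ) :
    (c • e3 : E3) 0 = 0 ∧ (c • e3 : E3) 1 = 0 ∧ (c • e3 : E3) 2 = c := by
  simp [e3]

/-! ### Unthreaded about every axis point, vortical everywhere, homogeneous nowhere -/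

/-- **Unthreaded about every point of the axis**: `⟪y − c e₂, curl u y⟫ = 0`. -/
theorem inner_sub_axis_curl_crossFlow {y : E3} (hy : 0 < y 0) (c : ℝ) : ⟪y - c • e3, curl (crossFlow γ) y⟫ = 0 := by
  obtain ⟨h0, h1, h2⟩ := axisPoint_apply c
  rw [curl_crossFlow γ hy, inner_add_right, inner_smul_right, inner_smul_right, EuclideanSpace.inner_single_right,
    EuclideanSpace.inner_single_right]
  simp [h0, h1]
  ring

/-- The second component of `curl u`: `−k y₀`. -/
theorem curl_crossFlow_apply_one {y : E3} (hy : 0 < y 0) :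
    curl (crossFlow γ) y 1 = -(Real.exp (-(γ * Real.log (cylRadius y) ^ 2)) / (y 0 ^ 2 + y 1 ^ 2) * y 0) := by
  rw [curl_crossFlow γ hy]
  simp

/-- **`curl u ≠ 0` at every point of the half-space.** -/
theorem curl_crossFlow_ne_zero {y : E3} (hy : 0 < y 0) : curl (crossFlow γ) y ≠ 0 := by
  intro h
  have h1 := curl_crossFlow_apply_one γ hy
  rw [h, PiLp.zero_apply] at h1
  have hk : 0 < Real.exp (-(γ * Real.log (cylRadius y) ^ 2)) / (y 0 ^ 2 + y 1 ^ 2) * y 0 :=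
    mul_pos (div_pos (Real.exp_pos _) (cylSq_pos hy)) hy
  linarith

/-- The first component of `Du(y)[y − c e₂] + u(y)` is `−2γ y₀/ρ²` (closed form). -/
theorem fderiv_radial_add_self_apply_zero {y : E3} (hy : 0 < y 0) (c : ℝ) :
    fderiv ℝ (crossFlow γ) y (y - c • e3) 0 + crossFlow γ y 0 = -(2 * γ * y 0) / (y 0 ^ 2 + y 1 ^ 2) := by
  obtain ⟨h0, h1, -⟩ := axisPoint_apply c
  have hs := cylSq_pos hy
  rw [fderiv_crossFlow_apply_zero γ hy, crossFlow_apply_zero, HalfSpace.cylRadius_sq]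
  simp only [PiLp.sub_apply, h0, h1, sub_zero]
  field_simp
  ring

/-- **Not (−1)-homogeneous about any axis point**, witnessed at EVERY point of the half-space. -/
theorem crossFlow_not_homogeneous_at (hγ : γ ≠ 0) {y : E3} (hy : 0 < y 0) (c : ℝ) :
    fderiv ℝ (crossFlow γ) y (y - c • e3) ≠ -(crossFlow γ y) := by
  have hs := cylSq_pos hy
  intro h
  have e := fderiv_radial_add_self_apply_zero γ hy c
  rw [h, PiLp.neg_apply, neg_add_cancel] at e
  have key : 2 * γ * y 0 / (y 0 ^ 2 + y 1 ^ 2) = 0 := by rw [neg_div] at e; linarith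
  rcases div_eq_zero_iff.1 key with h' | h'
  · rcases mul_eq_zero.1 h' with h'' | h''
    · rcases mul_eq_zero.1 h'' with h3 | h3
      · norm_num at h3
      · exact hγ h3
    · exact (ne_of_gt hy) h''
  · exact (ne_of_gt hs) h'

/-! ### No symmetry axis on any open subset of the half-space -/

/-- **Row two of the equivariance identity**: at a point `p` of the half-space, `Du(p)[w × (p − c e₂)] = w × u(p)` gives
`k(p₂ − c)(p₀w₁ − p₁w₀) = w₀u₁(p) − w₁u₀(p)`, `k = e^{−γ log²ρ}/ρ²`. -/
theorem rowTwo {p : E3} (hp : 0 < p 0) {c : ℝ} {w : E3}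
    (hE : fderiv ℝ (crossFlow γ) p (cross w (p - c • e3)) = cross w (crossFlow γ p)) :
    Real.exp (-(γ * Real.log (cylRadius p) ^ 2)) / (p 0 ^ 2 + p 1 ^ 2) * (p 2 - c) * (p 0 * w 1 - p 1 * w 0) =
      w 0 * crossFlow γ p 1 - w 1 * crossFlow γ p 0 := by
  obtain ⟨h0, h1, h2⟩ := axisPoint_apply c
  have e := congrArg (fun u : E3 => u 2) hE
  simp only at e
  rw [fderiv_crossFlow_apply_two γ hp, cross_apply_zero, cross_apply_one, cross_apply_two] at e
  simp only [PiLp.sub_apply, h0, h1, h2, sub_zero] at e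
  linear_combination e

/-- **Row zero for an axial vector along `e₂`**, closed form: the first component of
`Du(p)[w₂ e₂ × (p − c e₂)] − w₂ e₂ × u(p)` is `−2γ w₂ p₁/ρ²`. -/
theorem rowZero_axial_apply {p : E3} (hp : 0 < p 0) (c w₂ : ℝ) :
    fderiv ℝ (crossFlow γ) p (cross (w₂ • e3) (p - c • e3)) 0 - cross (w₂ • e3) (crossFlow γ p) 0 =
      -(2 * γ * w₂ * p 1) / (p 0 ^ 2 + p 1 ^ 2) := by
  obtain ⟨h0, h1, h2⟩ := axisPoint_apply c
  have hs := cylSq_pos hp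
  have hw : (w₂ • e3 : E3) 0 = 0 ∧ (w₂ • e3 : E3) 1 = 0 ∧ (w₂ • e3 : E3) 2 = w₂ := by simp [e3]
  obtain ⟨hw0, hw1, hw2⟩ := hw
  rw [fderiv_crossFlow_apply_zero γ hp, cross_apply_zero, cross_apply_one, cross_apply_zero, crossFlow_apply_one,
    crossFlow_apply_two, HalfSpace.cylRadius_sq]
  simp only [PiLp.sub_apply, h0, h1, h2, hw0, hw1, hw2, sub_zero, zero_mul, zero_sub]
  field_simp
  ring

/-- Hence the equivariance identity for `w = w₂ e₂` at `p` forces `γ w₂ p₁ = 0`. -/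
theorem rowZero_axial {p : E3} (hp : 0 < p 0) {c w₂ : ℝ}
    (hE : fderiv ℝ (crossFlow γ) p (cross (w₂ • e3) (p - c • e3)) = cross (w₂ • e3) (crossFlow γ p)) :
    γ * w₂ * p 1 = 0 := by
  have hs := cylSq_pos hp
  have e := rowZero_axial_apply γ hp c w₂
  rw [hE, sub_self] at e
  have key : 2 * γ * w₂ * p 1 / (p 0 ^ 2 + p 1 ^ 2) = 0 := by rw [neg_div] at e; linarith
  rcases div_eq_zero_iff.1 key with h' | h'
  · linarith
  · exact absurd h' (ne_of_gt hs)

/-- The cross flow does not see `z`: `u(p + δ e₂) = u(p)`. -/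
theorem crossFlow_add_axial (p : E3) (δ : ℝ) : crossFlow γ (p + δ • e3) = crossFlow γ p := by
  have h0 : (p + δ • e3 : E3) 0 = p 0 := by simp [e3]
  have h1 : (p + δ • e3 : E3) 1 = p 1 := by simp [e3]
  have hc : cylRadius (p + δ • e3) = cylRadius p := by rw [cylRadius, cylRadius, h0, h1]
  have ha : azimuth (p + δ • e3) = azimuth p := by rw [azimuth, azimuth, h0, h1]
  rw [crossFlow_eq]
  simp only [h0, h1, hc, ha]

/-- ★ **No symmetry axis on any nonempty open subset of the half-space** (for any axis point `c e₂` as centre; the swirl clause of C♭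
is not needed). -/
theorem crossFlow_noAxis_on (hγ : γ ≠ 0) {U : Set E3} (hU : IsOpen U) (hsub : ∀ y ∈ U, 0 < y 0) (hne : U.Nonempty) (c : ℝ) :
    ¬ ∃ A : E3 →L[ℝ] E3, IsSkewAxis A ∧ IsEquivariantOn U (c • e3) A (crossFlow γ) := by
  rintro ⟨A, ⟨hskew, hA0⟩, hE⟩
  obtain ⟨w, hw⟩ := SilentShells.TwoAxes.exists_cross_of_skew A (skew_of_inner_self_eq_zero hskew)
  have hEq : ∀ p ∈ U, fderiv ℝ (crossFlow γ) p (cross w (p - c • e3)) = cross w (crossFlow γ p) := fun p hp => by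
    have h := hE p hp
    rwa [hw, hw] at h
  -- an `ε`-ball inside `U` about some point `y`
  obtain ⟨y, hy⟩ := hne
  obtain ⟨ε, hε, hball⟩ := Metric.isOpen_iff.1 hU y hy
  set δ : ℝ := ε / 3 with hδ
  have hδpos : 0 < δ := by positivity
  have mem : ∀ (s t : ℝ), |s| ≤ δ → |t| ≤ δ → y + s • EuclideanSpace.single 1 (1 : ℝ) + t • e3 ∈ U := by
    intro s t hs ht
    apply hball
    rw [mem_ball, dist_eq_norm, add_assoc, add_sub_cancel_left]
    have h1 : ‖s • (EuclideanSpace.single 1 (1 : ℝ) : E3)‖ ≤ δ := by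
      rw [norm_smul, PiLp.norm_single, Real.norm_eq_abs]; simpa using hs
    have h2 : ‖t • (e3 : E3)‖ ≤ δ := by
      rw [norm_smul, e3, PiLp.norm_single, Real.norm_eq_abs]; simpa using ht
    calc ‖s • (EuclideanSpace.single 1 (1 : ℝ) : E3) + t • e3‖ ≤ δ + δ := (norm_add_le _ _).trans (add_le_add h1 h2)
      _ < ε := by rw [hδ]; linarith
  -- the key step: at `p = y + s e₁` (with `p`, `p + δ e₂ ∈ U`), row two at the two heights gives `p₀ w₁ = p₁ w₀`
  have step : ∀ s : ℝ, |s| ≤ δ → (y 0) * w 1 = (y 1 + s) * w 0 := by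
    intro s hs
    set p : E3 := y + s • EuclideanSpace.single 1 (1 : ℝ) with hpdef
    have hp0 : p 0 = y 0 := by simp [hpdef]
    have hp1 : p 1 = y 1 + s := by simp [hpdef]
    have hpU : p ∈ U := by simpa [hpdef] using mem s 0 hs (by simp [hδpos.le])
    have hp'U : p + δ • e3 ∈ U := by
      have := mem s δ hs (by rw [abs_of_pos hδpos])
      simpa [hpdef] using this
    have hp : 0 < p 0 := hsub p hpU
    have hp' : 0 < (p + δ • e3 : E3) 0 := hsub _ hp'U
    have r1 := rowTwo γ hp (hEq p hpU)
    have r2 := rowTwo γ hp' (hEq _ hp'U)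
    rw [crossFlow_add_axial] at r2
    have e0 : (p + δ • e3 : E3) 0 = p 0 := by simp [e3]
    have e1 : (p + δ • e3 : E3) 1 = p 1 := by simp [e3]
    have e2 : (p + δ • e3 : E3) 2 = p 2 + δ := by simp [e3]
    have ec : cylRadius (p + δ • e3) = cylRadius p := by rw [cylRadius, cylRadius, e0, e1]
    rw [e0, e1, e2, ec] at r2
    have hk : 0 < Real.exp (-(γ * Real.log (cylRadius p) ^ 2)) / (p 0 ^ 2 + p 1 ^ 2) := div_pos (Real.exp_pos _) (cylSq_pos hp)
    have hd : Real.exp (-(γ * Real.log (cylRadius p) ^ 2)) / (p 0 ^ 2 + p 1 ^ 2) * δ * (p 0 * w 1 - p 1 * w 0) = 0 := by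
      linear_combination r2 - r1
    rcases mul_eq_zero.1 hd with h | h
    · rcases mul_eq_zero.1 h with h' | h'
      · exact absurd h' hk.ne'
      · exact absurd h' hδpos.ne'
    · rw [hp0, hp1] at h; linarith
  -- two values of `s` ⇒ `w₀ = 0`, then `w₁ = 0`
  have hy0 : 0 < y 0 := hsub y hy
  have hw0 : w 0 = 0 := by
    have a := step 0 (by simp [hδpos.le])
    have b := step δ (by rw [abs_of_pos hδpos])
    have : δ * w 0 = 0 := by linarith
    exact (mul_eq_zero.1 this).resolve_left hδpos.ne'
  have hw1 : w 1 = 0 := by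
    have a := step 0 (by simp [hδpos.le])
    rw [hw0, mul_zero] at a
    exact (mul_eq_zero.1 a).resolve_left hy0.ne'
  -- `w = w₂ e₂`; row zero at a point with `y₁ ≠ 0` gives `w₂ = 0`
  have hwe : w = (w 2) • e3 := by
    ext j; fin_cases j <;> simp [e3, hw0, hw1]
  have hw2 : w 2 = 0 := by
    by_cases hy1 : y 1 = 0
    · -- use the point `y + δ e₁`, whose second coordinate is `δ ≠ 0`
      set p : E3 := y + δ • EuclideanSpace.single 1 (1 : ℝ) with hpdef
      have hpU : p ∈ U := by simpa [hpdef] using mem δ 0 (by rw [abs_of_pos hδpos]) (by simp [hδpos.le])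
      have hp : 0 < p 0 := hsub p hpU
      have hp1 : p 1 = δ := by simp [hpdef, hy1]
      have h := hEq p hpU
      rw [hwe] at h
      have r := rowZero_axial γ hp h
      rw [hp1] at r
      rcases mul_eq_zero.1 r with r' | r'
      · exact (mul_eq_zero.1 r').resolve_left hγ
      · exact absurd r' hδpos.ne'
    · have h := hEq y hy
      rw [hwe] at h
      have r := rowZero_axial γ hy0 h
      rcases mul_eq_zero.1 r with r' | r'
      · exact (mul_eq_zero.1 r').resolve_left hγ
      · exact absurd r' hy1
  apply hA0
  ext v i
  rw [hw, hwe, hw2]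
  simp [cross, crossProduct]

/-! ### K♭ on every ball of the half-space, about every axis point -/

/-- ★★ **K♭ on every ball inside the half-space, with every axis point as centre.** -/
theorem sectorialCrossFlows_everyBall (hγ : γ ≠ 0) (c : ℝ) {x₁ : E3} {r : ℝ} (hr : 0 < r) (hB : ∀ y ∈ ball x₁ r, 0 < y 0) :
    AnalyticOnNhd ℝ (crossFlow γ) (ball x₁ r) ∧ AnalyticOnNhd ℝ (crossFlowPressure γ) (ball x₁ r) ∧
    IsSteadyNSOn (ball x₁ r) (crossFlow γ) (crossFlowPressure γ) ∧ IsUnthreadedOn (ball x₁ r) (c • e3) (crossFlow γ) ∧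
    (∃ x ∈ ball x₁ r, curl (crossFlow γ) x ≠ 0) ∧ ¬ IsMinusOneHomogeneousOn (ball x₁ r) (c • e3) (crossFlow γ) ∧
    ¬ ∃ A : E3 →L[ℝ] E3, IsSkewAxis A ∧ IsEquivariantOn (ball x₁ r) (c • e3) A (crossFlow γ) ∧
      HasConstantSwirlOn (ball x₁ r) (c • e3) A (crossFlow γ) := by
  have hc : x₁ ∈ ball x₁ r := mem_ball_self hr
  refine ⟨fun y hy => analyticAt_crossFlow γ (hB y hy), fun y hy => analyticAt_crossFlowPressure γ (hB y hy), ?_,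
    fun y hy => inner_sub_axis_curl_crossFlow γ (hB y hy) c, ⟨x₁, hc, curl_crossFlow_ne_zero γ (hB x₁ hc)⟩,
    fun h => crossFlow_not_homogeneous_at γ hγ (hB x₁ hc) c (h x₁ hc), ?_⟩
  · refine ⟨?_, ?_, ?_, ?_⟩
    · exact fun y hy => ((analyticAt_crossFlow γ (hB y hy)).contDiffAt (n := 3)).contDiffWithinAt
    · exact fun y hy => ((analyticAt_crossFlowPressure γ (hB y hy)).contDiffAt (n := 1)).contDiffWithinAt
    · exact fun y hy => divergence_crossFlow γ (hB y hy)
    · exact fun y hy => crossFlow_momentum γ (hB y hy)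
  · rintro ⟨A, hA, hE, -⟩
    exact crossFlow_noAxis_on γ hγ isOpen_ball hB ⟨x₁, hc⟩ c ⟨A, hA, hE⟩

/-- **The body of C♭ fails on every ball of the half-space, about every axis point.** -/
theorem steadyLocalRigidityOffCentre_fails_everyBall (hγ : γ ≠ 0) (c : ℝ) {x₁ : E3} {r : ℝ} (hr : 0 < r)
    (hB : ∀ y ∈ ball x₁ r, 0 < y 0) :
    ¬ (AnalyticOnNhd ℝ (crossFlow γ) (ball x₁ r) → AnalyticOnNhd ℝ (crossFlowPressure γ) (ball x₁ r) →
        IsSteadyNSOn (ball x₁ r) (crossFlow γ) (crossFlowPressure γ) → IsUnthreadedOn (ball x₁ r) (c • e3) (crossFlow γ) →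
        (∃ x ∈ ball x₁ r, curl (crossFlow γ) x ≠ 0) → ¬ IsMinusOneHomogeneousOn (ball x₁ r) (c • e3) (crossFlow γ) →
        ∃ A : E3 →L[ℝ] E3, IsSkewAxis A ∧ IsEquivariantOn (ball x₁ r) (c • e3) A (crossFlow γ) ∧
          HasConstantSwirlOn (ball x₁ r) (c • e3) A (crossFlow γ)) := by
  obtain ⟨hV, hp, hNS, hU, hcurl, hhom, hnot⟩ := sectorialCrossFlows_everyBall γ hγ c hr hB
  exact fun h => hnot (h hV hp hNS hU hcurl hhom)

end Summit.NavierStokesRegularity.NavierStokesRegularity.Theorems.PoloidalLiouville.AzimuthalCartan.CrossFlow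

end
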